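import Literature.Barriers.CriticalPhenomena.PositionSpaceRGNonGibbsianSpacingSelectionProofs
import HarnessLib

/-!
# Barrier `PositionSpaceRGNonGibbsian`, Theorem 4.3: screening of the `±` exterior for every
# core-local observable of the internal-spin system with the origin frozen

Companion file on the Theorem 4.3 line of
`Literature/Barriers/CriticalPhenomena/PositionSpaceRGNonGibbsian.lean` (van Enter–Fernández–Sokal,
J. Stat. Phys. **72** (1993) 879, arXiv:hep-lat/9210032, §4.3.1 Steps 2.1–2.2 and §4.3.2). The tree's
`…SpacingSelectionProofs.lean` proves the insensitivity to the `±` exterior of the expectation of the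
UNFIXED spin at the origin (`VEFS1993_screening_holds`). The assembly of Theorem 4.3 through the
paper's own route (4.7)–(4.9) (`…Thm43Holds.lean`) needs the same insensitivity for the observables
`e^{∓2β ∑_{y∼0} σ_y}` of the system with the origin FROZEN; this file provides it for every bounded
measurable observable of the spins on the core sites:

* `isingExpect_update_eq_tilt_ratio` — `⟨f⟩^{ζ_{R'}[0↦s]}_{ℤ^d;Λ^int_{R'};β,0} = ⟨T_s f⟩/⟨T_s⟩` with
  `⟨·⟩ = ⟨·⟩^{s_out}_{𝔻_b;Λ^int_{R'};β,h⁺}` the periodic all-`+` image system and `T_s` the core tilt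
  (the finite-volume perturbation formula `μ'(·) = μ(· e^{-W})/μ(e^{-W})` of Step 2.2, generalising
  the tree's `isingPartitionFunction_update_eq_fieldZ_mul` from `f = 1`);
* `tendsto_isingExpect_local_plus_sub_minus` — for `b ≥ 2`, `β > 0`, parity `p`, core radius `R`,
  origin value `s` and every bounded measurable `f` depending only on the spins of `spCoreSites d b R`:
  `⟨f⟩^{ζ_{R'}[0↦s], + ext} - ⟨f⟩^{ζ_{R'}[0↦s], - ext} → 0` as `R' → ∞` (uniqueness at the field sites
  of `⟨∞;+⟩`, `tendsto_per_plus_sub_minus_spacing`).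

Nothing is asserted: the file is sorry-free and introduces no named fact (D-0014, D-0026).

## References

* A. C. D. van Enter, R. Fernández, A. D. Sokal, J. Stat. Phys. 72 (1993) 879–1167,
  arXiv:hep-lat/9210032 — §4.3.1 Step 2.2 and §4.3.2 [VanenterFernandezSokal1993].
* S. Friedli, Y. Velenik, *Statistical Mechanics of Lattice Systems*, CUP 2017, Lemma 3.33 and
  §3.6.3 [FriedliVelenik2017].
-/

noncomputable section

namespace Literature.Barriers.CriticalPhenomena.NonGibbs

open MeasureTheory Finset Filter Topology Literature.Probability.LatticeModels

variable {d : ℕ}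

/-- **The expectation of a core-local observable with the origin frozen to `s`, as a ratio of tilted
expectations in the periodic system** (bridge to the `b`-diluted graph, field congruence, locality of
the boundary condition, field tilt): for `b ≥ 2`, `R' ≥ R + 1` and every measurable `f` depending only
on the spins of `spCoreSites d b R`,
`⟨f⟩^{ζ_{R'}[0↦s]}_{ℤ^d;Λ^int_{R'};β,0} = ⟨T_s f⟩^{s_out}_{𝔻_b;Λ^int_{R'};β,h⁺} / ⟨T_s⟩^{s_out}_{𝔻_b;Λ^int_{R'};β,h⁺}`.
[cite: VanenterFernandezSokal1993, §4.3.1 Step 2.2] -/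
theorem isingExpect_update_eq_tilt_ratio {b : ℕ} (hb : 2 ≤ b) (p : ℤˣ) {R R' : ℕ} (hRR' : R + 1 ≤ R')
    (β : ℝ) (s_out s : ℤˣ) {f : SpinConfig (Site d) → ℝ} (hfm : Measurable f)
    (hloc : ∀ σ σ' : SpinConfig (Site d), (∀ k ∈ spCoreSites d b R, σ k = σ' k) → f σ = f σ') :
    isingExpect (zdGraph d) (spacingIntVolume d b R') β 0
        (.fixed (Function.update (signedCoreAnnulusBC d b p R R' 1 s_out) 0 s)) f =
      fieldExpect (spDilutedGraph d b) (spacingIntVolume d b R') β (imgField d b 1) (.fixed fun _ => s_out)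
          (fun σ => spCoreTilt d b p R β s σ * f σ) /
        fieldExpect (spDilutedGraph d b) (spacingIntVolume d b R') β (imgField d b 1) (.fixed fun _ => s_out)
          (spCoreTilt d b p R β s) := by
  set Λ := spacingIntVolume d b R' with hΛ
  set ζ := Function.update (signedCoreAnnulusBC d b p R R' 1 s_out) 0 s with hζ
  have hint : ∀ x ∈ Λ, ¬ IsSpImageSite d b x := fun x hx => not_isSpImageSite_of_mem_spacingIntVolume hx
  have hTf : Measurable fun σ => spCoreTilt d b p R β s σ * f σ := (measurable_spCoreTilt b p R β s).mul hfm
  -- the weights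
  have hw : ∀ τ : Λ → ℤˣ, isingWeight (zdGraph d) Λ β 0 (.fixed ζ) τ =
      fieldWeight (spDilutedGraph d b) Λ β (imgField d b 1) (.fixed fun _ => s_out) τ *
        spCoreTilt d b p R β s (glue Λ τ (.fixed fun _ => s_out)) := by
    intro τ
    rw [isingWeight_zd_eq_fieldWeight_spDiluted hint β ζ τ]
    have h2 : fieldWeight (spDilutedGraph d b) Λ β (imgField d b ζ) (.fixed ζ) τ =
        fieldWeight (spDilutedGraph d b) Λ β (imgField d b (spCoreConfig d b p R s)) (.fixed ζ) τ := by
      unfold fieldWeight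
      rw [fieldHamiltonian_congr (spDilutedGraph d b) (fun x hx => imgField_update_signedCoreAnnulusBC_eq hb p R s_out s hx)]
    have h3 : fieldWeight (spDilutedGraph d b) Λ β (imgField d b (spCoreConfig d b p R s)) (.fixed ζ) τ =
        fieldWeight (spDilutedGraph d b) Λ β (imgField d b (spCoreConfig d b p R s)) (.fixed fun _ => s_out) τ :=
      fieldWeight_fixed_congr_outerBoundary (spDilutedGraph d b)
        (fun y hy => update_signedCoreAnnulusBC_apply_outerBoundary p R R' s_out s hy) β _ τ
    rw [h2, h3, fieldWeight_field_tilt (spDilutedGraph d b) Λ β (imgField d b 1)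
      (imgField d b (spCoreConfig d b p R s)) (.fixed fun _ => s_out) τ]
    have hsum : ∑ x ∈ Λ, (imgField d b (spCoreConfig d b p R s) x - imgField d b 1 x) *
          spinAt x (glue Λ τ (.fixed fun _ => s_out)) =
        ∑ x ∈ spCoreSites d b R, (imgField d b (spCoreConfig d b p R s) x - imgField d b 1 x) *
            spinAt x (glue Λ τ (.fixed fun _ => s_out)) := by
      symm
      refine Finset.sum_subset (spCoreSites_subset_spacingIntVolume hb hRR') fun x _ hxK => ?_
      rw [imgField_spCoreConfig_eq_of_notMem (by omega) p s hxK, sub_self, zero_mul]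
    rw [hsum]
    rfl
  -- the observable sees only the spins of `Λ`
  have hf : ∀ τ : Λ → ℤˣ, f (glue Λ τ (.fixed ζ)) = f (glue Λ τ (.fixed fun _ => s_out)) := fun τ =>
    hloc _ _ fun k hk => by
      have hkΛ : k ∈ Λ := spCoreSites_subset_spacingIntVolume hb hRR' hk
      rw [glue_apply_of_mem _ _ _ hkΛ, glue_apply_of_mem _ _ _ hkΛ]
  rw [isingExpect_eq_sum_div (zdGraph d) Λ 0 (.fixed ζ) β hfm,
    isingPartitionFunction_update_eq_fieldZ_mul hb p hRR' β s_out s,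
    fieldExpect_eq_sum_div (spDilutedGraph d b) Λ β (imgField d b 1) (.fixed fun _ => s_out) hTf,
    div_div]
  have hnum : ∑ τ : Λ → ℤˣ, isingWeight (zdGraph d) Λ β 0 (.fixed ζ) τ * f (glue Λ τ (.fixed ζ)) =
      ∑ τ : Λ → ℤˣ, fieldWeight (spDilutedGraph d b) Λ β (imgField d b 1) (.fixed fun _ => s_out) τ *
        (spCoreTilt d b p R β s (glue Λ τ (.fixed fun _ => s_out)) * f (glue Λ τ (.fixed fun _ => s_out))) :=
    Finset.sum_congr rfl fun τ _ => by rw [hw τ, hf τ]; ring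
  rw [hnum]

/-- **Screening for core-local observables with the origin frozen** (Steps 2.1–2.2 of §4.3.1 for the
fixed-origin systems): for `b ≥ 2`, `β > 0`, parity `p`, core radius `R`, origin value `s` and every
bounded measurable `f` depending only on the spins of the core sites,
`⟨f⟩^{ζ_{R'}[0↦s]; + ext}_{Λ^int_{R'}} - ⟨f⟩^{ζ_{R'}[0↦s]; - ext}_{Λ^int_{R'}} → 0` as `R' → ∞`.
[cite: VanenterFernandezSokal1993, §4.3.1 Steps 2.1–2.2 and §4.3.2] -/
theorem tendsto_isingExpect_local_plus_sub_minus {b : ℕ} (hb : 2 ≤ b) {β : ℝ} (hβ : 0 < β) (p : ℤˣ)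
    (R : ℕ) (s : ℤˣ) {f : SpinConfig (Site d) → ℝ} (hfm : Measurable f)
    (hloc : ∀ σ σ' : SpinConfig (Site d), (∀ k ∈ spCoreSites d b R, σ k = σ' k) → f σ = f σ')
    {M : ℝ} (hfM : ∀ σ, |f σ| ≤ M) :
    Tendsto (fun R' =>
      isingExpect (zdGraph d) (spacingIntVolume d b R') β 0
          (.fixed (Function.update (signedCoreAnnulusBC d b p R R' 1 1) 0 s)) f -
        isingExpect (zdGraph d) (spacingIntVolume d b R') β 0
          (.fixed (Function.update (signedCoreAnnulusBC d b p R R' 1 (-1)) 0 s)) f) atTop (𝓝 0) := by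
  -- numerators and denominators in the periodic system
  set A : ℤˣ → ℕ → ℝ := fun s_out R' =>
    fieldExpect (spDilutedGraph d b) (spacingIntVolume d b R') β (imgField d b 1) (.fixed fun _ => s_out)
      (fun σ => spCoreTilt d b p R β s σ * f σ) with hA
  set D : ℤˣ → ℕ → ℝ := fun s_out R' =>
    fieldExpect (spDilutedGraph d b) (spacingIntVolume d b R') β (imgField d b 1) (.fixed fun _ => s_out)
      (spCoreTilt d b p R β s) with hD
  set b₀ : ℝ := Real.exp (-(β * spCoreTiltExp d b R)) with hb₀
  set B : ℝ := Real.exp (β * spCoreTiltExp d b R) with hB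
  have hb₀pos : 0 < b₀ := Real.exp_pos _
  have hM : 0 ≤ M := (abs_nonneg _).trans (hfM 1)
  have hTm := measurable_spCoreTilt (d := d) b p R β s
  have hTfm : Measurable fun σ => spCoreTilt d b p R β s σ * f σ := hTm.mul hfm
  have hDge : ∀ s_out R', b₀ ≤ D s_out R' := fun s_out R' => by
    have := fieldExpect_mono_fun (spDilutedGraph d b) (spacingIntVolume d b R') β (imgField d b 1)
      (.fixed fun _ => s_out) measurable_const hTm fun σ => (spCoreTilt_mem_Icc b p R hβ.le s σ).1
    rwa [fieldExpect_const_fun] at this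
  have hAle : ∀ s_out R', |A s_out R'| ≤ B * M := fun s_out R' => by
    rw [abs_le]
    have hup := fieldExpect_mono_fun (spDilutedGraph d b) (spacingIntVolume d b R') β (imgField d b 1)
      (.fixed fun _ => s_out) hTfm measurable_const fun σ => show spCoreTilt d b p R β s σ * f σ ≤ B * M from by
        have h1 := (spCoreTilt_mem_Icc b p R hβ.le s σ).2
        have h0 : 0 ≤ spCoreTilt d b p R β s σ := (Real.exp_pos _).le
        have h2 := (abs_le.1 (hfM σ)).2
        nlinarith
    have hlo := fieldExpect_mono_fun (spDilutedGraph d b) (spacingIntVolume d b R') β (imgField d b 1)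
      (.fixed fun _ => s_out) measurable_const hTfm fun σ => show -(B * M) ≤ spCoreTilt d b p R β s σ * f σ from by
        have h1 := (spCoreTilt_mem_Icc b p R hβ.le s σ).2
        have h0 : 0 ≤ spCoreTilt d b p R β s σ := (Real.exp_pos _).le
        have h2 := (abs_le.1 (hfM σ)).1
        nlinarith
    rw [fieldExpect_const_fun] at hup hlo
    exact ⟨hlo, hup⟩
  -- insensitivity to `±`
  have hTloc := spCoreTilt_local (d := d) b p R β s
  have hinsA : Tendsto (fun R' => A 1 R' - A (-1) R') atTop (𝓝 0) :=
    tendsto_per_plus_sub_minus_spacing hb hβ R hTfm fun σ σ' h => by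
      show spCoreTilt d b p R β s σ * f σ = spCoreTilt d b p R β s σ' * f σ'
      rw [hTloc σ σ' h, hloc σ σ' h]
  have hinsD : Tendsto (fun R' => D 1 R' - D (-1) R') atTop (𝓝 0) :=
    tendsto_per_plus_sub_minus_spacing hb hβ R hTm hTloc
  have hlim := tendsto_div_sub_div_atTop_nhds_zero (a := A 1) (a' := A (-1)) (b := D 1) (b' := D (-1))
    hb₀pos (hAle 1) (hAle (-1)) (hDge 1) (hDge (-1)) hinsA hinsD
  refine hlim.congr' ?_
  filter_upwards [eventually_ge_atTop (R + 1)] with R' hR'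
  rw [isingExpect_update_eq_tilt_ratio hb p hR' β 1 s hfm hloc,
    isingExpect_update_eq_tilt_ratio hb p hR' β (-1) s hfm hloc]

/-- The value of the boundary conditions at the origin is the parity `p` (so freezing the origin to
`p` does not change them). [cite: VanenterFernandezSokal1993, §4.3.1 Step 2] -/
theorem signedCoreAnnulusBC_zero {b : ℕ} (hb : 0 < b) (p : ℤˣ) (R R' : ℕ) (s_ann s_out : ℤˣ) :
    signedCoreAnnulusBC d b p R R' s_ann s_out 0 = p := by
  classical
  have h := signedCoreAnnulusBC_apply_image (d := d) hb p R R' s_ann s_out (0 : Site d)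
  have h0 : (fun i => (b : ℤ) * (0 : Site d) i) = (0 : Site d) := by funext i; simp
  rw [h0] at h
  rw [h, if_pos (zero_mem_box d R), altConfig_zero, mul_one]

/-- **Screening, origin frozen to its pattern value**: with `s = p` the updated boundary condition
is the pattern itself. [cite: VanenterFernandezSokal1993, §4.3.1 Steps 2.1–2.2] -/
theorem tendsto_isingExpect_local_plus_sub_minus' {b : ℕ} (hb : 2 ≤ b) {β : ℝ} (hβ : 0 < β) (p : ℤˣ)
    (R : ℕ) {f : SpinConfig (Site d) → ℝ} (hfm : Measurable f)
    (hloc : ∀ σ σ' : SpinConfig (Site d), (∀ k ∈ spCoreSites d b R, σ k = σ' k) → f σ = f σ')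
    {M : ℝ} (hfM : ∀ σ, |f σ| ≤ M) :
    Tendsto (fun R' =>
      isingExpect (zdGraph d) (spacingIntVolume d b R') β 0 (.fixed (signedCoreAnnulusBC d b p R R' 1 1)) f -
        isingExpect (zdGraph d) (spacingIntVolume d b R') β 0 (.fixed (signedCoreAnnulusBC d b p R R' 1 (-1))) f)
      atTop (𝓝 0) := by
  have key : ∀ R' s_out, Function.update (signedCoreAnnulusBC d b p R R' 1 s_out) 0 p =
      signedCoreAnnulusBC d b p R R' 1 s_out := fun R' s_out =>
    Function.update_eq_self_iff.2 (signedCoreAnnulusBC_zero (d := d) (b := b) (by omega) p R R' 1 s_out).symm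
  have h := tendsto_isingExpect_local_plus_sub_minus hb hβ p R p hfm hloc hfM
  simp only [key] at h
  exact h

end Literature.Barriers.CriticalPhenomena.NonGibbs

end
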